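import Summits.NavierStokesRegularity.FluidComputer.ClayBlowupNormalisedPressure
import HarnessLib

/-!
# Slab integrability THROUGH the lifespan of a Clay blow-up: `u ∈ L³`, `p̃[u] ∈ L^{3/2}`,
# `Δ⁻¹∇·f ∈ L²`, `f ∈ L³` on `(0, T) × ℝ³`

Cell `ns-blowup`, seat `ns-blowup-ecbridge-2` (g6; the E–C endpoint theory seat). LABEL: E–C typing
(KERNEL — no named fact). WHAT THIS IS NOT: not Navier–Stokes evidence — integrability bookkeeping about
the TYPE `ClayBlowup ν` (no inhabitant is claimed anywhere). Companion memo: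
`run/shared/lean/pub/ns-blowup/ecbridge2/ECBRIDGE-2-MEMO-5.md`.

## Content (step 2 of `ClayBlowup ν → DesignedBlowup ν`, MEMO-4 §4 (i))

The decay at spatial infinity of the Caffarelli–Kohn–Nirenberg functionals
`∫₀ᵀ∫_{B_{3/2}(x₀)} (|u|³ + |p_N|^{3/2})`, `∫₀ᵀ∫_{B_{3/2}(x₀)} |f|³` (the hypotheses of the forced far-field
ε-regularity theorem `IsSuitableWeakSolutionOn.farField_bound_of_ckn_decay_force`) is the tail of
FINITE slab integrals. This file proves the finiteness, for every Clay blow-up at `ν > 0`, with no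
hypothesis beyond the type:

* §0 two elementary `ℝ≥0∞` inequalities (`|b|^{3/2} ≤ δ^{3/2} + δ^{-1/2}|b|²`,
  `|a + b|^{3/2} ≤ 2(|a|^{3/2} + |b|^{3/2})`) used to separate the force-potential part of the pressure,
  which is NOT in `L^{3/2}` near spatial infinity in general;
* §1 `exists_lintegral_cube_slice_le` / `lintegral_slab_cube_lt_top` — `∫|u(t)|³ ≤ c(1 + ∫|∇u(t)|²)` on
  `[0, T)` from ONE energy bound (`energy_le`) by Sobolev and Lebesgue interpolation
  (`SereginSverak2002.lintegral_enorm_pow_three_le_of_hasWeakGradient`), hence `u ∈ L³((0,T) × ℝ³)` by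
  the integrable dissipation (`lintegral_dissipation_lt_top`); `lintegral_slab_normalisedPressure_lt_top`
  — Stein's `L^{3/2}` bound slice-wise; `lintegral_slab_forcePotential_sq_lt_top`,
  `lintegral_slab_force_rpow_three_lt_top` — the Clay force and its potential `Δ⁻¹∇·f`
  (`clayForce_forcePotential_bounds`, `clayForce_slice_sup_L1`, `clayForce_slice_bounds`);
  `aestronglyMeasurable_normalisedPressure_slice`.

References: T. Tao, Anal. PDE 6 (2013), Lemma 8.1 [cite: Tao2011, Lemma 8.1]; E. M. Stein, *Singular
integrals* (1970), Ch. II §4.2 Thm 3 [cite: Stein1971, Ch. II §4.2 Thm. 3]; C. L. Fefferman, Clay problem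
description, (5) [cite: FeffermanClay2006, (5)]; P. G. Lemarié-Rieusset (2016), proof of Thm. 14.5
(p. 512) [cite: LemarieRieusset2016, Thm. 14.5].
-/

noncomputable section

namespace Summit.NavierStokesRegularity.FluidComputer

open Set MeasureTheory Filter Topology Function TopologicalSpace Metric Bornology
open scoped ENNReal ContDiff NNReal
open Literature.Analysis.FluidPDE
open Summit.NavierStokesRegularity.NavierStokesRegularity
open Summit.NavierStokesRegularity.FluidComputer.PalasekTowerClayBridge
open Summit.NavierStokesRegularity.FluidComputer.ClayForcedLerayHopf

/-! ## §0 Two elementary `ℝ≥0∞` inequalities -/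

/-- `|b|^{3/2} ≤ δ^{3/2} + δ^{-1/2} |b|²` for `δ < ∞` (split at `b ≤ δ`). [folklore] -/
theorem rpow_threeHalves_le_add (b : ℝ≥0∞) {δ : ℝ≥0∞} (hδt : δ ≠ ⊤) :
    b ^ (3 / 2 : ℝ) ≤ δ ^ (3 / 2 : ℝ) + δ⁻¹ ^ (1 / 2 : ℝ) * b ^ 2 := by
  rcases le_or_gt b δ with h | h
  · exact (ENNReal.rpow_le_rpow h (by norm_num)).trans le_self_add
  · have hb0 : b ≠ 0 := by
      rintro rfl
      exact ENNReal.not_lt_zero h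
    rcases eq_or_ne b ⊤ with rfl | hbt
    · have hne : δ⁻¹ ^ (1 / 2 : ℝ) ≠ 0 := by
        intro h0
        rw [ENNReal.rpow_eq_zero_iff] at h0
        rcases h0 with ⟨h1, -⟩ | ⟨-, h2⟩
        · exact hδt (ENNReal.inv_eq_zero.1 h1)
        · norm_num at h2
      have htop : δ⁻¹ ^ (1 / 2 : ℝ) * (⊤ : ℝ≥0∞) ^ 2 = ⊤ := by
        rw [ENNReal.top_pow (by norm_num), ENNReal.mul_top hne]
      rw [htop]
      exact le_top.trans le_add_self
    · have e : b ^ (3 / 2 : ℝ) = b ^ 2 * b⁻¹ ^ (1 / 2 : ℝ) := by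
        rw [ENNReal.inv_rpow, ← ENNReal.rpow_neg, ← ENNReal.rpow_two,
          ← ENNReal.rpow_add _ _ hb0 hbt]
        norm_num
      rw [e, mul_comm]
      refine le_add_left (mul_le_mul' (ENNReal.rpow_le_rpow ?_ (by norm_num)) le_rfl)
      exact ENNReal.inv_le_inv.2 h.le

/-- `|a + b|^{3/2} ≤ 2 (|a|^{3/2} + |b|^{3/2})` (in `ℝ≥0∞`; the mean inequality with `2^{1/2} ≤ 2`).
[folklore] -/
theorem enorm_add_rpow_threeHalves_le (a b : ℝ) :
    ‖a + b‖ₑ ^ (3 / 2 : ℝ) ≤ 2 * (‖a‖ₑ ^ (3 / 2 : ℝ) + ‖b‖ₑ ^ (3 / 2 : ℝ)) := by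
  have h1 : ‖a + b‖ₑ ^ (3 / 2 : ℝ) ≤ (‖a‖ₑ + ‖b‖ₑ) ^ (3 / 2 : ℝ) :=
    ENNReal.rpow_le_rpow (enorm_add_le a b) (by norm_num)
  have h2 := ENNReal.rpow_add_le_mul_rpow_add_rpow ‖a‖ₑ ‖b‖ₑ (p := (3 / 2 : ℝ)) (by norm_num)
  have h3 : (2 : ℝ≥0∞) ^ ((3 / 2 : ℝ) - 1) ≤ 2 := by
    have := ENNReal.rpow_le_rpow_of_exponent_le (x := 2) (by norm_num)
      (show (3 / 2 : ℝ) - 1 ≤ 1 by norm_num)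
    rwa [ENNReal.rpow_one] at this
  exact h1.trans (h2.trans (mul_le_mul' h3 le_rfl))

namespace ClayBlowup

variable {ν : ℝ} (X : ClayBlowup ν)

/-! ## §1 Slab integrability through the lifespan -/

/-- **The cubic slice bound through the lifespan**: there is `c < ∞` with
`∫ |u(t)|³ ≤ c (1 + ∫ |∇u(t)|²)` for every `0 ≤ t < T` (ONE energy bound on `[0, T)`, Sobolev
`‖v‖₆ ≲ ‖∇v‖₂` and `‖v‖₃ ≤ ‖v‖₂^{1/2}‖v‖₆^{1/2}` slice-wise; `ν > 0`; no named fact).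
[cite: Tao2011, Lemma 8.1] -/
theorem exists_lintegral_cube_slice_le (hν : 0 < ν) :
    ∃ c : ℝ≥0∞, c ≠ ⊤ ∧ ∀ t ∈ Ico 0 X.T,
      ∫⁻ x, ‖X.u t x‖ₑ ^ (3 : ℕ) ≤
        c * (1 + ∫⁻ x, ENNReal.ofReal (frobeniusNormSq (fderiv ℝ (X.u t) x))) := by
  obtain ⟨A, hAt, hA⟩ := X.energy_le hν
  set K : ℝ≥0∞ :=
    (SNormLESNormFDerivOfEqConst (EuclideanSpace ℝ (Fin 3))
      (volume : Measure (EuclideanSpace ℝ (Fin 3))) 2 : ℝ≥0∞) with hK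
  set c : ℝ≥0∞ := A ^ (3 / 4 : ℝ) * K ^ (3 / 2 : ℝ) with hc
  have hct : c ≠ ⊤ := ENNReal.mul_ne_top (ENNReal.rpow_ne_top_of_nonneg (by norm_num) hAt.ne)
    (ENNReal.rpow_ne_top_of_nonneg (by norm_num) ENNReal.coe_ne_top)
  refine ⟨c, hct, fun t ht => ?_⟩
  have hsm : ContDiff ℝ ∞ (X.u t) := X.classical.contDiff_velocity ht
  have hmem : MemLp (X.u t) 2 volume :=
    memLp_two_of_lintegral_enorm_sq_lt_top hsm.continuous.aestronglyMeasurable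
      ((hA t ht).trans_lt hAt)
  have hG : HasWeakGradient (X.u t) (fderiv ℝ (X.u t)) :=
    hasWeakGradient_fderiv_of_contDiff (hsm.of_le (by exact_mod_cast le_top))
  refine (SereginSverak2002.lintegral_enorm_pow_three_le_of_hasWeakGradient hmem hG (hA t ht)).trans
    ?_
  rw [hc, mul_assoc]
  gcongr
  exact ENNReal.rpow_three_quarters_le_one_add _

/-- **`u ∈ L³((0, T) × ℝ³)` through the lifespan** of a Clay blow-up (`ν > 0`): integrate the slice
bound against the integrable dissipation. No named fact. [cite: Tao2011, Lemma 8.1] -/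
theorem lintegral_slab_cube_lt_top (hν : 0 < ν) :
    ∫⁻ z in Ioo 0 X.T ×ˢ (univ : Set (EuclideanSpace ℝ (Fin 3))), ‖X.u z.1 z.2‖ₑ ^ (3 : ℕ) < ⊤ := by
  obtain ⟨c, hct, hslice⟩ := X.exists_lintegral_cube_slice_le hν
  have hdis := X.lintegral_dissipation_lt_top hν
  refine (SereginSverak2002.lintegral_slab_le_lintegral_lintegral _ _).trans_lt ?_
  have hae : ∀ᵐ t ∂(volume.restrict (Ioo 0 X.T)), ∫⁻ x, ‖X.u t x‖ₑ ^ (3 : ℕ) ≤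
      c * (1 + ∫⁻ x, ENNReal.ofReal (frobeniusNormSq (fderiv ℝ (X.u t) x))) := by
    filter_upwards [ae_restrict_mem measurableSet_Ioo] with t ht
    exact hslice t ⟨ht.1.le, ht.2⟩
  calc ∫⁻ t in Ioo 0 X.T, ∫⁻ x, ‖X.u t x‖ₑ ^ (3 : ℕ)
      ≤ ∫⁻ t in Ioo 0 X.T, c * (1 + ∫⁻ x, ENNReal.ofReal (frobeniusNormSq (fderiv ℝ (X.u t) x))) :=
        lintegral_mono_ae hae
    _ = c * (volume (Ioo 0 X.T) +
          ∫⁻ t in Ioo 0 X.T, ∫⁻ x, ENNReal.ofReal (frobeniusNormSq (fderiv ℝ (X.u t) x))) := by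
        rw [lintegral_const_mul' _ _ hct, lintegral_add_left measurable_const, setLIntegral_const,
          one_mul]
    _ < ⊤ := by
        refine ENNReal.mul_lt_top hct.lt_top (ENNReal.add_lt_top.2 ⟨?_, hdis⟩)
        rw [Real.volume_Ioo]; exact ENNReal.ofReal_lt_top

/-- **`p̃[u] = -Δ⁻¹∂ᵢ∂ⱼ(uᵢuⱼ) ∈ L^{3/2}((0, T) × ℝ³)` through the lifespan** (Stein's `L^{3/2}` bound
slice-wise, `lintegral_normalisedPressure_rpow_le`, and the cubic slice bound; `ν > 0`; no named fact).
[cite: Stein1971, Ch. II §4.2 Thm. 3] -/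
theorem lintegral_slab_normalisedPressure_lt_top (hν : 0 < ν) :
    ∫⁻ z in Ioo 0 X.T ×ˢ (univ : Set (EuclideanSpace ℝ (Fin 3))),
      ‖normalisedPressure (X.u z.1) z.2‖ₑ ^ (3 / 2 : ℝ) < ⊤ := by
  obtain ⟨c, hct, hslice⟩ := X.exists_lintegral_cube_slice_le hν
  obtain ⟨A, hAt, hA⟩ := X.energy_le hν
  have hdis := X.lintegral_dissipation_lt_top hν
  set C₀ : ℝ≥0∞ := (steinConstThreeHalves : ℝ≥0∞) ^ (3 / 2 : ℝ) with hC₀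
  have hC₀t : C₀ ≠ ⊤ := ENNReal.rpow_ne_top_of_nonneg (by norm_num) ENNReal.coe_ne_top
  have hCc : C₀ * c ≠ ⊤ := ENNReal.mul_ne_top hC₀t hct
  refine (SereginSverak2002.lintegral_slab_le_lintegral_lintegral _ _).trans_lt ?_
  have hae : ∀ᵐ t ∂(volume.restrict (Ioo 0 X.T)),
      ∫⁻ x, ‖normalisedPressure (X.u t) x‖ₑ ^ (3 / 2 : ℝ) ≤
        C₀ * c * (1 + ∫⁻ x, ENNReal.ofReal (frobeniusNormSq (fderiv ℝ (X.u t) x))) := by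
    filter_upwards [ae_restrict_mem measurableSet_Ioo] with t htI
    have ht : t ∈ Ico 0 X.T := ⟨htI.1.le, htI.2⟩
    have hsm : ContDiff ℝ ∞ (X.u t) := X.classical.contDiff_velocity ht
    have hmem : MemLp (X.u t) 2 volume :=
      memLp_two_of_lintegral_enorm_sq_lt_top hsm.continuous.aestronglyMeasurable
        ((hA t ht).trans_lt hAt)
    have hL2 : Integrable fun y => ‖X.u t y‖ ^ 2 := hmem.integrable_norm_pow two_ne_zero
    calc ∫⁻ x, ‖normalisedPressure (X.u t) x‖ₑ ^ (3 / 2 : ℝ)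
        ≤ C₀ * ∫⁻ x, ‖X.u t x‖ₑ ^ (3 : ℕ) :=
          SereginSverak2002.lintegral_normalisedPressure_rpow_le hsm hL2
      _ ≤ C₀ * (c * (1 + ∫⁻ x, ENNReal.ofReal (frobeniusNormSq (fderiv ℝ (X.u t) x)))) := by
          gcongr; exact hslice t ht
      _ = C₀ * c * (1 + ∫⁻ x, ENNReal.ofReal (frobeniusNormSq (fderiv ℝ (X.u t) x))) := by
          rw [mul_assoc]
  calc ∫⁻ t in Ioo 0 X.T, ∫⁻ x, ‖normalisedPressure (X.u t) x‖ₑ ^ (3 / 2 : ℝ)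
      ≤ ∫⁻ t in Ioo 0 X.T, C₀ * c *
          (1 + ∫⁻ x, ENNReal.ofReal (frobeniusNormSq (fderiv ℝ (X.u t) x))) :=
        lintegral_mono_ae hae
    _ = C₀ * c * (volume (Ioo 0 X.T) +
          ∫⁻ t in Ioo 0 X.T, ∫⁻ x, ENNReal.ofReal (frobeniusNormSq (fderiv ℝ (X.u t) x))) := by
        rw [lintegral_const_mul' _ _ hCc, lintegral_add_left measurable_const, setLIntegral_const,
          one_mul]
    _ < ⊤ := by
        refine ENNReal.mul_lt_top hCc.lt_top (ENNReal.add_lt_top.2 ⟨?_, hdis⟩)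
        rw [Real.volume_Ioo]; exact ENNReal.ofReal_lt_top

/-- **`Δ⁻¹∇·f ∈ L²((0, T) × ℝ³)`** for the Clay force of a Clay blow-up (the uniform slice bound
`clayForce_forcePotential_bounds` integrated over the finite interval). No named fact.
[cite: FeffermanClay2006, (5)] -/
theorem lintegral_slab_forcePotential_sq_lt_top :
    ∫⁻ z in Ioo 0 X.T ×ˢ (univ : Set (EuclideanSpace ℝ (Fin 3))),
      ‖forcePotential (X.f z.1) z.2‖ₑ ^ 2 < ⊤ := by
  obtain ⟨Pf, hPft, hPf⟩ := clayForce_forcePotential_bounds X.force_smooth X.force_decay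
  refine (SereginSverak2002.lintegral_slab_le_lintegral_lintegral _ _).trans_lt ?_
  have hae : ∀ᵐ t ∂(volume.restrict (Ioo 0 X.T)),
      ∫⁻ x, ‖forcePotential (X.f t) x‖ₑ ^ 2 ≤ Pf := by
    filter_upwards [ae_restrict_mem measurableSet_Ioo] with t htI
    exact (hPf t htI.1.le).2
  calc ∫⁻ t in Ioo 0 X.T, ∫⁻ x, ‖forcePotential (X.f t) x‖ₑ ^ 2
      ≤ ∫⁻ _ in Ioo 0 X.T, Pf := lintegral_mono_ae hae
    _ = Pf * volume (Ioo 0 X.T) := setLIntegral_const _ _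
    _ < ⊤ := by
        refine ENNReal.mul_lt_top hPft ?_
        rw [Real.volume_Ioo]; exact ENNReal.ofReal_lt_top

/-- **`f ∈ L³((0, T) × ℝ³)`** for the Clay force of a Clay blow-up (`|f|³ ≤ sup|f| · |f|²` and the
uniform slice bounds `clayForce_slice_sup_L1`, `clayForce_slice_bounds`). No named fact.
[cite: FeffermanClay2006, (5)] -/
theorem lintegral_slab_force_rpow_three_lt_top :
    ∫⁻ z in Ioo 0 X.T ×ˢ (univ : Set (EuclideanSpace ℝ (Fin 3))),
      ‖X.f z.1 z.2‖ₑ ^ (3 : ℝ) < ⊤ := by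
  obtain ⟨M, N, -, hMN⟩ := clayForce_slice_sup_L1 X.force_smooth X.force_decay
  obtain ⟨⟨C₀, hC₀⟩, -⟩ := ClayForceSliceBounds.clayForce_slice_bounds X.force_smooth X.force_decay
  have hM0 : 0 ≤ M := (norm_nonneg _).trans ((hMN 0 le_rfl).1 0)
  refine (SereginSverak2002.lintegral_slab_le_lintegral_lintegral _ _).trans_lt ?_
  have hpt : ∀ t, 0 ≤ t → ∀ x, ‖X.f t x‖ₑ ^ (3 : ℝ) ≤ ENNReal.ofReal M * ‖X.f t x‖ₑ ^ 2 := by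
    intro t ht x
    have e : ‖X.f t x‖ₑ ^ (3 : ℝ) = ‖X.f t x‖ₑ * ‖X.f t x‖ₑ ^ 2 := by
      rw [show (3 : ℝ) = ((3 : ℕ) : ℝ) by norm_num, ENNReal.rpow_natCast]; ring
    rw [e]
    refine mul_le_mul' ?_ le_rfl
    rw [← ofReal_norm]
    exact ENNReal.ofReal_le_ofReal ((hMN t ht).1 x)
  have hae : ∀ᵐ t ∂(volume.restrict (Ioo 0 X.T)),
      ∫⁻ x, ‖X.f t x‖ₑ ^ (3 : ℝ) ≤ ENNReal.ofReal M * C₀ := by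
    filter_upwards [ae_restrict_mem measurableSet_Ioo] with t htI
    calc ∫⁻ x, ‖X.f t x‖ₑ ^ (3 : ℝ) ≤ ∫⁻ x, ENNReal.ofReal M * ‖X.f t x‖ₑ ^ 2 :=
          lintegral_mono (hpt t htI.1.le)
      _ = ENNReal.ofReal M * ∫⁻ x, ‖X.f t x‖ₑ ^ 2 := lintegral_const_mul' _ _ ENNReal.ofReal_ne_top
      _ ≤ ENNReal.ofReal M * C₀ := mul_le_mul' le_rfl (hC₀ t htI.1.le)
  calc ∫⁻ t in Ioo 0 X.T, ∫⁻ x, ‖X.f t x‖ₑ ^ (3 : ℝ)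
      ≤ ∫⁻ _ in Ioo 0 X.T, ENNReal.ofReal M * C₀ := lintegral_mono_ae hae
    _ = ENNReal.ofReal M * C₀ * volume (Ioo 0 X.T) := setLIntegral_const _ _
    _ < ⊤ := by
        refine ENNReal.mul_lt_top (ENNReal.mul_lt_top ENNReal.ofReal_lt_top ENNReal.coe_lt_top) ?_
        rw [Real.volume_Ioo]; exact ENNReal.ofReal_lt_top

/-- **The normalised-pressure slice of a Clay blow-up is measurable** (`u(t) ∈ L² ∩ L^∞ ⊂ L⁴`, so
Stein's class with exponent `2` applies; `ν > 0`). [cite: Stein1971, Ch. II §4.2 Thm. 3] -/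
theorem aestronglyMeasurable_normalisedPressure_slice (hν : 0 < ν) {t : ℝ} (ht : t ∈ Ico 0 X.T) :
    AEStronglyMeasurable (normalisedPressure (X.u t)) volume := by
  obtain ⟨A, hAt, hA⟩ := X.energy_le hν
  obtain ⟨B, hB⟩ := X.exists_norm_le hν ht.2
  have hsm : ContDiff ℝ ∞ (X.u t) := X.classical.contDiff_velocity ht
  have hu4 : MemLp (X.u t) 4 volume :=
    memLp_four_of_bound_of_lintegral_sq hsm.continuous (hB t ⟨ht.1, le_rfl⟩)
      ((hA t ht).trans_lt hAt)
  have hu4' : MemLp (X.u t) (2 * 2) volume := by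
    rw [show (2 : ℝ≥0∞) * 2 = 4 by norm_num]; exact hu4
  exact (memLp_normalisedPressure_of_memLp_two_mul (p := 2) (by norm_num) (by simp) hu4').1

end ClayBlowup

end Summit.NavierStokesRegularity.FluidComputer

end
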